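import Summits.QuantumFields.YangMills.Theorems.UnitScaleTiltProp7CornerCombFlatL1Localised
import Summits.QuantumFields.YangMills.Theorems.UnitScaleTiltProp7CornerCombChainPerCorner
import HarnessLib

/-!
# (n3)-COMB (II), row `hMcomb₂`, located difficulty H2-1 — THE `ℓ¹` ENGINE WITH POINTWISE HYPOTHESES (dressed-ready):
# `ℓ¹` of a cornered tower `Q_k = G_k + ∇Λ_k` from POINTWISE one-step domination, with corner-localised reading (any `d`, any `L ≥ 1`)

Crux `stmt-QuantumFields-19200` `MinimiserStabilityRegPr`, route-R E′ (A′)-on-Σ, P-A2 (β); supplier design (II) (★routeR-w1 g9 MASTER 6efb31c3 §4: H2-1), ★px17 g4's H-line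
(H-4∕H-4b ✓∕⧗: `hMcomb₂ ⟸ H2-1(E) ⟸` per-(l, j) `ℓ¹` bounds of the HOMOGENEOUS propagations of tied sources over the level-`l` period cell), px13 g6 «GO» 07:47:21Z (flat knit ✓p708982).
Width seat `ym3-torus-px18` (gen 4); `--kind proof --supports stmt-QuantumFields-19200 --as helper`; THEOREMS ONLY (0 `def`, 0 `sorry`); «(O2) groundwork — not consumed by any displayed
row before the freeze lifts»; count-neutral.  YM₃ on T³ is a ladder rung (R3), not Clay; nothing here is progress on the YM mass gap.

## The point
✓p708982 knits the FLAT tower through ✓II-1's exact recursion `S (m+1) z κ = Σ_r L⁻ᵈ • asum (S m) (L•z + r) (seg κ L)`.  The DRESSED tower of ★routeR-w1 ✓p704390 `cornerComb_structure`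
(`Q_k Y = G_k + (Λ_k z − Ad_{Ū_k(z,κ)} Λ_k(z + e_κ))`, `G_{k+1} = T_k G_k − ∇^{cov} CM_k(G_k)`, `Λ_{k+1} z = CM_k(G_k) z + Λ_k(L•z)`) is not an exact straight average, but with
`CM := FhatCov` ✓F-5a∕F-5b give the POINTWISE domination `‖G_{k+1}(z,κ)‖ ≤ L⁻ᵈ·Σ_{r,t<L}‖G_k(L•z + r + t•e_κ, κ)‖ + a_k·Σ_{s,ν}(‖G_k(L•z + s, ν)‖ + ‖G_k(L•z + L•e_κ + s, ν)‖)`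
(transports are isometries; `a_k = 210·α_k·(2d+2)L`, `√(two-block ℓ²) ≤` two-block `ℓ¹`), and ✓F-6a-1's letters give `‖FhatCov L V X y‖ ≤ Σ_r L⁻ᵈ·Σ_{steps}‖X(step)‖`.  This file is the `ℓ¹`
bookkeeping FROM SUCH POINTWISE HYPOTHESES ONLY — values in any seminormed group, no algebra, no transports: the member∕dressed file discharges the three pointwise rows from F-4∕F-5∕F-6a and
unitarity, instantiates the absorbing chains with cornered boxes ∕ period cells, and prices the reading boxes with ✓p705643∕✓p706697 (+ ✓p708988's double sums).

## What is here (ns `…Theorems.Prop7CornerCombL1Engine`; letters lit `B7Prop1Explicit`: `Site`, `boxVec`, `e`, `treeWord`; `𝔸` any seminormed additive group; `CM`, `G`, `Λ` in ✓p704390's shapes)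
* §1 RE-INDEXING ROWS: ★ `sum_block_offset_le` (`Σ_{z∈Zc}Σ_s g(L•z + v + s) ≤ Σ_{y∈Zf} g y`, lit ✓`blockMap_injective`), ★ `sum_segments_le` (`Σ_{z∈Zc}Σ_{r,t<L} g(L•z + r + t•e_κ) ≤ L·Σ_{y∈Zf} g y`,
  ✓`card_fiber_le`) — for `g ≥ 0` and absorbing `Zf`.
* §2 ★★ `sum_norm_step_le_of_pointwise` — ONE STEP: `Σ_{z∈Zc}Σ_κ‖G′ z κ‖ ≤ (L·L⁻ᵈ + 2d·a)·Σ_{y∈Zf}Σ_ν‖G y ν‖` from the pointwise domination;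
  ★★ `sum_norm_tower_le_of_pointwise` — TOWER along an absorbing chain: `Σ_{Z k}‖G k‖ ≤ (Π_{m<k}(L·L⁻ᵈ + 2d·a_m))·Σ_{Z 0}‖G 0‖`.
* §3 ★ `le_box_of_steps_bound` — CORNER PIECE from the pointwise tree-step bound: `c ≤ Σ_r L⁻ᵈ·Σ_{steps}‖G(step)‖ ⇒ c ≤ d·L·Σ_{x∈Bx}Σ_μ‖G x μ‖` (any `Bx ⊇` step sites);
  ★★ `le_localised_of_steps_bound` (∘ §2's tower along a localised chain `U`: `c ≤ d·L·(Π_{m<i}(…))·Σ_{x∈U 0}Σ_μ‖G 0 x μ‖`).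
* §4 `norm_unrolled_le` (triangle inequality on ✓F-6c-3a `gauge_unroll`: `Λ_k z = Σ_{i<k} CM_i(G_i)(L^{k−1−i}•z)` for ✓p704390's recursion `Λ_{k+1} z = CM_k(G_k) z + Λ_k(L•z)`, `Λ_0 = 0`);
  ★★★ `sum_norm_le_localised_of_pointwise` — THE ROW: from the pointwise structure bound `‖Q z κ‖ ≤ ‖G_k z κ‖ + ‖Λ_k z‖ + ‖Λ_k(z + e κ)‖`, the recursions and the three pointwise rows,
  `Σ_{z∈Zk}Σ_κ‖Q z κ‖ ≤ (Π_{m<k} w_m)·Σ_{Z 0}‖G 0‖ + d·L·Σ_{i<k}(Π_{m<i} w_m)·Σ_{z∈Zk}Σ_κ(Σ_{x∈U i (L^{k−1−i}•z) 0}‖G 0‖ + Σ_{x∈U i (L^{k−1−i}•(z+e κ)) 0}‖G 0‖)`, `w_m := L·L⁻ᵈ + 2d·a_m`.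
DEPENDENCE: the weights are the displayed closed expressions in `(d, L, a_m)`; NOTHING reads `k` beyond them, nor the torus, `K`, `n`, the member.  In the application `Π(1 + 2dL^{d−1}a_m) ≤
exp(c·Σα_m)` is geometric-from-the-top bookkeeping of the member file (MASTER §1 row 4), not done here.
HONEST: finite-sum bookkeeping; nothing of H2-1's member ∕ `hMcomb₂` ∕ `hMcomb` ∕ (β) ∕ `hD` ∕ the crux is proved or claimed; rung R3 (YM₃ on T³), NOT d = 4, NOT infinite volume, NOT Clay;
YM gap NOT proved.  References: T. Bałaban, CMP 98 (1985) 17–51 [Balaban1985Averaging] ((42)–(43) pp.23–24, (125) p.36, (119) p.35).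
-/

set_option autoImplicit false

open scoped BigOperators
open Finset
open Literature.MathematicalPhysics.QuantumFieldTheory.Balaban1983to89.B7Prop1Explicit
open Literature.MathematicalPhysics.QuantumFieldTheory.Balaban1983to89.T4AveragingDeficitWallBoundary (blockMap_injective)
open Summit.QuantumFields.YangMills.Theorems.Prop7CornerCombFlatJensen (card_fiber_le)
open Summit.QuantumFields.YangMills.Theorems.Prop7CornerCombFlatPieces (sum_weight_length_treeWord_le)
open Summit.QuantumFields.YangMills.Theorems.Prop7CornerCombFlatL1Localised (norm_list_map_sum_le)
open Summit.QuantumFields.YangMills.Theorems.Prop7CornerCombChainPerCorner (gauge_unroll)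

namespace Summit.QuantumFields.YangMills.Theorems.Prop7CornerCombL1Engine

variable {d : ℕ} {𝔸 : Type*} [SeminormedAddCommGroup 𝔸]

/-! ## §1 Re-indexing rows: blocks and segments into an absorbing set -/

/-- ★ **BLOCKS INTO AN ABSORBING SET**: for `g ≥ 0` on `Zf` and `L•z + v + s ∈ Zf` for all `z ∈ Zc`, `s ∈ [0,L)ᵈ` (fixed offset `v`):
`Σ_{z∈Zc}Σ_s g(L•z + v + s) ≤ Σ_{y∈Zf} g y` — the block decomposition is injective (lit ✓`blockMap_injective`). [folklore] [cite: Balaban1985Averaging, (2) p.17] -/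
theorem sum_block_offset_le (L : ℕ) (hL : 1 ≤ L) (Zc Zf : Finset (Site d)) (v : Site d) (g : Site d → ℝ) (hg : ∀ y ∈ Zf, 0 ≤ g y)
    (hZf : ∀ z ∈ Zc, ∀ s : Fin d → Fin L, (L : ℤ) • z + v + boxVec L s ∈ Zf) :
    ∑ z ∈ Zc, ∑ s : Fin d → Fin L, g ((L : ℤ) • z + v + boxVec L s) ≤ ∑ y ∈ Zf, g y := by
  classical
  set P : Finset (Site d × (Fin d → Fin L)) := Zc ×ˢ (Finset.univ : Finset (Fin d → Fin L)) with hP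
  set π : Site d × (Fin d → Fin L) → Site d := fun p => (L : ℤ) • p.1 + v + boxVec L p.2 with hπ
  have hinj : Set.InjOn π ↑P := by
    intro p _ p' _ h
    have h' : (L : ℤ) • p.1 + boxVec L p.2 = (L : ℤ) • p'.1 + boxVec L p'.2 := by
      have := congrArg (fun w => w - v) h
      simp only [hπ] at this
      have e1 : (L : ℤ) • p.1 + v + boxVec L p.2 - v = (L : ℤ) • p.1 + boxVec L p.2 := by abel
      have e2 : (L : ℤ) • p'.1 + v + boxVec L p'.2 - v = (L : ℤ) • p'.1 + boxVec L p'.2 := by abel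
      rw [e1, e2] at this
      exact this
    have := blockMap_injective L hL (a₁ := (p.1, p.2)) (a₂ := (p'.1, p'.2)) h'
    exact Prod.ext (congrArg Prod.fst this) (congrArg Prod.snd this)
  have hsub : P.image π ⊆ Zf := by
    intro y hy
    obtain ⟨p, hp, rfl⟩ := Finset.mem_image.mp hy
    rw [hP, Finset.mem_product] at hp
    exact hZf p.1 hp.1 p.2
  calc ∑ z ∈ Zc, ∑ s : Fin d → Fin L, g ((L : ℤ) • z + v + boxVec L s)
      = ∑ p ∈ P, g (π p) := by rw [hP, Finset.sum_product]
    _ = ∑ y ∈ P.image π, g y := (Finset.sum_image hinj).symm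
    _ ≤ ∑ y ∈ Zf, g y := Finset.sum_le_sum_of_subset_of_nonneg hsub fun y hy _ => hg y hy

/-- ★ **SEGMENTS INTO AN ABSORBING SET**: for `g ≥ 0` on `Zf` and `L•z + r + t•e_κ ∈ Zf` (`z ∈ Zc`, `r ∈ [0,L)ᵈ`, `t < L`):
`Σ_{z∈Zc}Σ_rΣ_{t<L} g(L•z + r + t•e_κ) ≤ L·Σ_{y∈Zf} g y` — fibres of size `≤ L` (✓`card_fiber_le`). [folklore] [cite: Balaban1985Averaging, (125) p.36] -/
theorem sum_segments_le (L : ℕ) (hL : 1 ≤ L) (κ : Fin d) (Zc Zf : Finset (Site d)) (g : Site d → ℝ) (hg : ∀ y ∈ Zf, 0 ≤ g y)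
    (hZf : ∀ z ∈ Zc, ∀ (r : Fin d → Fin L) (t : ℕ), t < L → (L : ℤ) • z + boxVec L r + (t : ℤ) • e κ ∈ Zf) :
    ∑ z ∈ Zc, ∑ r : Fin d → Fin L, ∑ t ∈ Finset.range L, g ((L : ℤ) • z + boxVec L r + (t : ℤ) • e κ) ≤ (L : ℝ) * ∑ y ∈ Zf, g y := by
  classical
  set P : Finset (Site d × ((Fin d → Fin L) × ℕ)) := Zc ×ˢ ((Finset.univ : Finset (Fin d → Fin L)) ×ˢ Finset.range L) with hP
  set π : Site d × ((Fin d → Fin L) × ℕ) → Site d := fun p => (L : ℤ) • p.1 + boxVec L p.2.1 + (p.2.2 : ℤ) • e κ with hπ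
  have h1 : ∑ z ∈ Zc, ∑ r : Fin d → Fin L, ∑ t ∈ Finset.range L, g ((L : ℤ) • z + boxVec L r + (t : ℤ) • e κ) = ∑ p ∈ P, g (π p) := by
    rw [hP, Finset.sum_product]
    simp only [Finset.sum_product, hπ]
  have hsub : P.image π ⊆ Zf := by
    intro y hy
    obtain ⟨p, hp, rfl⟩ := Finset.mem_image.mp hy
    rw [hP, Finset.mem_product, Finset.mem_product] at hp
    exact hZf p.1 hp.1 p.2.1 p.2.2 (Finset.mem_range.mp hp.2.2)
  have hmult : ∀ y ∈ Zf, #{p ∈ P | π p = y} ≤ L := by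
    intro y _
    refine card_fiber_le L hL κ _ (fun p hp => ?_) y
    rw [hP, Finset.mem_product, Finset.mem_product] at hp
    exact Finset.mem_range.mp hp.2.2
  rw [h1, Finset.sum_comp (s := P) (f := g) (g := π)]
  calc ∑ y ∈ P.image π, (#{p ∈ P | π p = y}) • g y
      ≤ ∑ y ∈ P.image π, (L : ℝ) * g y := by
        refine Finset.sum_le_sum fun y hy => ?_
        rw [nsmul_eq_mul]
        exact mul_le_mul_of_nonneg_right (by exact_mod_cast hmult y (hsub hy)) (hg y (hsub hy))
    _ ≤ ∑ y ∈ Zf, (L : ℝ) * g y := Finset.sum_le_sum_of_subset_of_nonneg hsub fun y hy _ => mul_nonneg (Nat.cast_nonneg _) (hg y hy)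
    _ = (L : ℝ) * ∑ y ∈ Zf, g y := by rw [Finset.mul_sum]

/-! ## §2 One step and the tower from POINTWISE domination -/

/-- ★★ **ONE STEP FROM POINTWISE DOMINATION**: if on `Zc`
`‖G′ z κ‖ ≤ L⁻ᵈ·Σ_{r,t<L}‖G(L•z + r + t•e_κ) κ‖ + a·Σ_{s,ν}(‖G(L•z + s) ν‖ + ‖G(L•z + L•e_κ + s) ν‖)` (straight average + two-block defect, `a ≥ 0`), and `Zf` absorbs the segments
and both blocks, then `Σ_{z∈Zc}Σ_κ‖G′ z κ‖ ≤ (L·L⁻ᵈ + 2d·a)·Σ_{y∈Zf}Σ_ν‖G y ν‖`. [cite: Balaban1985Averaging, (125) p.36, (119) p.35] -/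
theorem sum_norm_step_le_of_pointwise (L : ℕ) (hL : 1 ≤ L) (G G' : Site d → Fin d → 𝔸) {a : ℝ} (ha : 0 ≤ a) (Zc Zf : Finset (Site d))
    (hpt : ∀ z ∈ Zc, ∀ κ : Fin d, ‖G' z κ‖ ≤
      ((L : ℝ) ^ d)⁻¹ * ∑ r : Fin d → Fin L, ∑ t ∈ Finset.range L, ‖G ((L : ℤ) • z + boxVec L r + (t : ℤ) • e κ) κ‖ +
        a * ∑ s : Fin d → Fin L, ∑ ν : Fin d, (‖G ((L : ℤ) • z + boxVec L s) ν‖ + ‖G ((L : ℤ) • z + (L : ℤ) • e κ + boxVec L s) ν‖))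
    (hZf : ∀ z ∈ Zc, ∀ (κ : Fin d) (r : Fin d → Fin L) (t : ℕ), t < L → (L : ℤ) • z + boxVec L r + (t : ℤ) • e κ ∈ Zf)
    (hZf' : ∀ z ∈ Zc, ∀ (κ : Fin d) (s : Fin d → Fin L), (L : ℤ) • z + (L : ℤ) • e κ + boxVec L s ∈ Zf) :
    ∑ z ∈ Zc, ∑ κ : Fin d, ‖G' z κ‖ ≤ ((L : ℝ) * ((L : ℝ) ^ d)⁻¹ + 2 * d * a) * ∑ y ∈ Zf, ∑ ν : Fin d, ‖G y ν‖ := by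
  classical
  set M : ℝ := ∑ y ∈ Zf, ∑ ν : Fin d, ‖G y ν‖ with hM
  have hc0 : 0 ≤ ((L : ℝ) ^ d)⁻¹ := by positivity
  -- the straight part, direction by direction
  have hstraight : ∀ κ : Fin d,
      ∑ z ∈ Zc, ((L : ℝ) ^ d)⁻¹ * ∑ r : Fin d → Fin L, ∑ t ∈ Finset.range L, ‖G ((L : ℤ) • z + boxVec L r + (t : ℤ) • e κ) κ‖
        ≤ (L : ℝ) * ((L : ℝ) ^ d)⁻¹ * ∑ y ∈ Zf, ‖G y κ‖ := by
    intro κ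
    rw [← Finset.mul_sum]
    have h := sum_segments_le L hL κ Zc Zf (fun y => ‖G y κ‖) (fun _ _ => norm_nonneg _) (fun z hz r t ht => hZf z hz κ r t ht)
    calc ((L : ℝ) ^ d)⁻¹ * ∑ z ∈ Zc, ∑ r : Fin d → Fin L, ∑ t ∈ Finset.range L, ‖G ((L : ℤ) • z + boxVec L r + (t : ℤ) • e κ) κ‖
        ≤ ((L : ℝ) ^ d)⁻¹ * ((L : ℝ) * ∑ y ∈ Zf, ‖G y κ‖) := mul_le_mul_of_nonneg_left h hc0
      _ = (L : ℝ) * ((L : ℝ) ^ d)⁻¹ * ∑ y ∈ Zf, ‖G y κ‖ := by ring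
  -- the two blocks, for every direction κ
  have hblock0 : ∀ κ : Fin d, ∑ z ∈ Zc, ∑ s : Fin d → Fin L, ∑ ν : Fin d, ‖G ((L : ℤ) • z + boxVec L s) ν‖ ≤ M := by
    intro κ
    have h := sum_block_offset_le L hL Zc Zf 0 (fun y => ∑ ν : Fin d, ‖G y ν‖) (fun _ _ => Finset.sum_nonneg fun _ _ => norm_nonneg _)
      (fun z hz s => by
        have := hZf z hz κ s 0 hL
        simpa using this)
    simpa using h
  have hblock1 : ∀ κ : Fin d, ∑ z ∈ Zc, ∑ s : Fin d → Fin L, ∑ ν : Fin d, ‖G ((L : ℤ) • z + (L : ℤ) • e κ + boxVec L s) ν‖ ≤ M := by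
    intro κ
    exact sum_block_offset_le L hL Zc Zf ((L : ℤ) • e κ) (fun y => ∑ ν : Fin d, ‖G y ν‖) (fun _ _ => Finset.sum_nonneg fun _ _ => norm_nonneg _)
      (fun z hz s => hZf' z hz κ s)
  -- assemble
  have hsum : ∑ z ∈ Zc, ∑ κ : Fin d, ‖G' z κ‖ ≤
      ∑ κ : Fin d, (∑ z ∈ Zc, (((L : ℝ) ^ d)⁻¹ * ∑ r : Fin d → Fin L, ∑ t ∈ Finset.range L, ‖G ((L : ℤ) • z + boxVec L r + (t : ℤ) • e κ) κ‖ +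
        a * ∑ s : Fin d → Fin L, ∑ ν : Fin d, (‖G ((L : ℤ) • z + boxVec L s) ν‖ + ‖G ((L : ℤ) • z + (L : ℤ) • e κ + boxVec L s) ν‖))) := by
    rw [Finset.sum_comm]
    exact Finset.sum_le_sum fun κ _ => Finset.sum_le_sum fun z hz => hpt z hz κ
  have hκ : ∀ κ : Fin d, ∑ z ∈ Zc, (((L : ℝ) ^ d)⁻¹ * ∑ r : Fin d → Fin L, ∑ t ∈ Finset.range L, ‖G ((L : ℤ) • z + boxVec L r + (t : ℤ) • e κ) κ‖ +
        a * ∑ s : Fin d → Fin L, ∑ ν : Fin d, (‖G ((L : ℤ) • z + boxVec L s) ν‖ + ‖G ((L : ℤ) • z + (L : ℤ) • e κ + boxVec L s) ν‖))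
      ≤ (L : ℝ) * ((L : ℝ) ^ d)⁻¹ * ∑ y ∈ Zf, ‖G y κ‖ + a * (2 * M) := by
    intro κ
    rw [Finset.sum_add_distrib]
    refine add_le_add (hstraight κ) ?_
    rw [← Finset.mul_sum]
    refine mul_le_mul_of_nonneg_left ?_ ha
    have hsplit : ∑ z ∈ Zc, ∑ s : Fin d → Fin L, ∑ ν : Fin d, (‖G ((L : ℤ) • z + boxVec L s) ν‖ + ‖G ((L : ℤ) • z + (L : ℤ) • e κ + boxVec L s) ν‖)
        = ∑ z ∈ Zc, ∑ s : Fin d → Fin L, ∑ ν : Fin d, ‖G ((L : ℤ) • z + boxVec L s) ν‖ +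
          ∑ z ∈ Zc, ∑ s : Fin d → Fin L, ∑ ν : Fin d, ‖G ((L : ℤ) • z + (L : ℤ) • e κ + boxVec L s) ν‖ := by
      simp only [Finset.sum_add_distrib]
    rw [hsplit]
    linarith [hblock0 κ, hblock1 κ]
  have hdir : ∑ κ : Fin d, ((L : ℝ) * ((L : ℝ) ^ d)⁻¹ * ∑ y ∈ Zf, ‖G y κ‖ + a * (2 * M))
      = (L : ℝ) * ((L : ℝ) ^ d)⁻¹ * M + d * (a * (2 * M)) := by
    rw [Finset.sum_add_distrib, Finset.sum_const, Finset.card_univ, Fintype.card_fin, nsmul_eq_mul, ← Finset.mul_sum, hM, Finset.sum_comm]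
  calc ∑ z ∈ Zc, ∑ κ : Fin d, ‖G' z κ‖
      ≤ ∑ κ : Fin d, ((L : ℝ) * ((L : ℝ) ^ d)⁻¹ * ∑ y ∈ Zf, ‖G y κ‖ + a * (2 * M)) := hsum.trans (Finset.sum_le_sum fun κ _ => hκ κ)
    _ = ((L : ℝ) * ((L : ℝ) ^ d)⁻¹ + 2 * d * a) * M := by rw [hdir]; ring

/-- ★★ **THE TOWER FROM POINTWISE DOMINATION ALONG AN ABSORBING CHAIN**: with per-level defect weights `a_m ≥ 0` and `w_m := L·L⁻ᵈ + 2d·a_m`,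
`Σ_{z∈Z k}Σ_κ‖G k z κ‖ ≤ (Π_{m<k} w_m)·Σ_{y∈Z 0}Σ_ν‖G 0 y ν‖` — LOCALISATION IS THE CHOICE OF `Z`. [cite: Balaban1985Averaging, (125) p.36, (43) p.24] -/
theorem sum_norm_tower_le_of_pointwise (L : ℕ) (hL : 1 ≤ L) (G : ℕ → Site d → Fin d → 𝔸) (a : ℕ → ℝ) (ha : ∀ m, 0 ≤ a m)
    (k : ℕ) (Z : ℕ → Finset (Site d))
    (hpt : ∀ m, m < k → ∀ z ∈ Z (m + 1), ∀ κ : Fin d, ‖G (m + 1) z κ‖ ≤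
      ((L : ℝ) ^ d)⁻¹ * ∑ r : Fin d → Fin L, ∑ t ∈ Finset.range L, ‖G m ((L : ℤ) • z + boxVec L r + (t : ℤ) • e κ) κ‖ +
        a m * ∑ s : Fin d → Fin L, ∑ ν : Fin d, (‖G m ((L : ℤ) • z + boxVec L s) ν‖ + ‖G m ((L : ℤ) • z + (L : ℤ) • e κ + boxVec L s) ν‖))
    (hZ : ∀ m, m < k → ∀ z ∈ Z (m + 1), ∀ (κ : Fin d) (r : Fin d → Fin L) (t : ℕ), t < L → (L : ℤ) • z + boxVec L r + (t : ℤ) • e κ ∈ Z m)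
    (hZ' : ∀ m, m < k → ∀ z ∈ Z (m + 1), ∀ (κ : Fin d) (s : Fin d → Fin L), (L : ℤ) • z + (L : ℤ) • e κ + boxVec L s ∈ Z m) :
    ∑ z ∈ Z k, ∑ κ : Fin d, ‖G k z κ‖ ≤
      (∏ m ∈ Finset.range k, ((L : ℝ) * ((L : ℝ) ^ d)⁻¹ + 2 * d * a m)) * ∑ y ∈ Z 0, ∑ ν : Fin d, ‖G 0 y ν‖ := by
  induction k with
  | zero => simp
  | succ k ih =>
    have hstep := sum_norm_step_le_of_pointwise L hL (G k) (G (k + 1)) (ha k) (Z (k + 1)) (Z k)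
      (hpt k (Nat.lt_succ_self k)) (hZ k (Nat.lt_succ_self k)) (hZ' k (Nat.lt_succ_self k))
    have ih' := ih (fun m hm => hpt m (Nat.lt_succ_of_lt hm)) (fun m hm => hZ m (Nat.lt_succ_of_lt hm)) (fun m hm => hZ' m (Nat.lt_succ_of_lt hm))
    have hw0 : 0 ≤ (L : ℝ) * ((L : ℝ) ^ d)⁻¹ + 2 * d * a k := by have := ha k; positivity
    calc ∑ z ∈ Z (k + 1), ∑ κ : Fin d, ‖G (k + 1) z κ‖
        ≤ ((L : ℝ) * ((L : ℝ) ^ d)⁻¹ + 2 * d * a k) * ∑ y ∈ Z k, ∑ ν : Fin d, ‖G k y ν‖ := hstep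
      _ ≤ ((L : ℝ) * ((L : ℝ) ^ d)⁻¹ + 2 * d * a k) *
          ((∏ m ∈ Finset.range k, ((L : ℝ) * ((L : ℝ) ^ d)⁻¹ + 2 * d * a m)) * ∑ y ∈ Z 0, ∑ ν : Fin d, ‖G 0 y ν‖) :=
          mul_le_mul_of_nonneg_left ih' hw0
      _ = (∏ m ∈ Finset.range (k + 1), ((L : ℝ) * ((L : ℝ) ^ d)⁻¹ + 2 * d * a m)) * ∑ y ∈ Z 0, ∑ ν : Fin d, ‖G 0 y ν‖ := by
          rw [Finset.prod_range_succ]; ring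

/-! ## §3 The corner piece from the pointwise tree-step bound -/

/-- ★ **CORNER PIECE FROM THE TREE-STEP BOUND**: if `c ≤ Σ_r L⁻ᵈ·Σ_{s ∈ steps(treeWord r from y)}‖G s.1 s.2.1‖` (e.g. `c = ‖FhatCov L V G y‖`, transports isometric) and `Bx`
contains every step site, then `c ≤ d·L·Σ_{x∈Bx}Σ_μ‖G x μ‖`. [cite: Balaban1985Averaging, (14) p.19, (42) p.23] -/
theorem le_box_of_steps_bound (L : ℕ) (hL : 1 ≤ L) (G : Site d → Fin d → 𝔸) (y : Site d) {c : ℝ}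
    (hc : c ≤ ∑ r : Fin d → Fin L, ((L : ℝ) ^ d)⁻¹ *
      ((List.zip (List.scanl (fun (z : Site d) (l' : Letter d) => z + l'.vec) y (treeWord (boxVec L r))) (treeWord (boxVec L r))).map
        fun s => ‖G s.1 s.2.1‖).sum)
    (Bx : Finset (Site d))
    (hBx : ∀ (r : Fin d → Fin L),
      ∀ s ∈ List.zip (List.scanl (fun (z : Site d) (l' : Letter d) => z + l'.vec) y (treeWord (boxVec L r))) (treeWord (boxVec L r)), s.1 ∈ Bx) :
    c ≤ d * L * ∑ x ∈ Bx, ∑ μ : Fin d, ‖G x μ‖ := by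
  classical
  set M : ℝ := ∑ x ∈ Bx, ∑ μ : Fin d, ‖G x μ‖ with hM
  have hM0 : 0 ≤ M := Finset.sum_nonneg fun _ _ => Finset.sum_nonneg fun _ _ => norm_nonneg _
  have hc0 : 0 ≤ ((L : ℝ) ^ d)⁻¹ := by positivity
  have hword : ∀ r : Fin d → Fin L,
      ((List.zip (List.scanl (fun (z : Site d) (l' : Letter d) => z + l'.vec) y (treeWord (boxVec L r))) (treeWord (boxVec L r))).map
          fun s => ‖G s.1 s.2.1‖).sum ≤ ((treeWord (boxVec L r)).length : ℝ) * M := by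
    intro r
    set steps := List.zip (List.scanl (fun (z : Site d) (l' : Letter d) => z + l'.vec) y (treeWord (boxVec L r))) (treeWord (boxVec L r))
      with hsteps
    have hlen : steps.length ≤ (treeWord (boxVec L r)).length := by
      rw [hsteps, List.length_zip]; exact min_le_right _ _
    have hterm : ∀ s ∈ steps, ‖G s.1 s.2.1‖ ≤ M := by
      intro s hs
      have hx : s.1 ∈ Bx := hBx r s hs
      calc ‖G s.1 s.2.1‖ ≤ ∑ μ : Fin d, ‖G s.1 μ‖ :=
            Finset.single_le_sum (f := fun μ => ‖G s.1 μ‖) (fun _ _ => norm_nonneg _) (Finset.mem_univ _)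
        _ ≤ M := Finset.single_le_sum (f := fun x => ∑ μ : Fin d, ‖G x μ‖) (fun _ _ => Finset.sum_nonneg fun _ _ => norm_nonneg _) hx
    calc (steps.map fun s => ‖G s.1 s.2.1‖).sum ≤ (steps.map fun _ => M).sum := List.sum_le_sum fun s hs => hterm s hs
      _ = (steps.length : ℝ) * M := by rw [List.map_const', List.sum_replicate, nsmul_eq_mul]
      _ ≤ ((treeWord (boxVec L r)).length : ℝ) * M := mul_le_mul_of_nonneg_right (by exact_mod_cast hlen) hM0
  calc c ≤ ∑ r : Fin d → Fin L, ((L : ℝ) ^ d)⁻¹ * (((treeWord (boxVec L r)).length : ℝ) * M) :=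
        hc.trans (Finset.sum_le_sum fun r _ => mul_le_mul_of_nonneg_left (hword r) hc0)
    _ = (∑ r : Fin d → Fin L, ((L : ℝ) ^ d)⁻¹ * ((treeWord (boxVec L r)).length : ℝ)) * M := by
        rw [Finset.sum_mul]; refine Finset.sum_congr rfl fun r _ => by ring
    _ ≤ (d * L) * M := mul_le_mul_of_nonneg_right (sum_weight_length_treeWord_le L hL) hM0
    _ = d * L * ∑ x ∈ Bx, ∑ μ : Fin d, ‖G x μ‖ := by rw [hM]

/-- ★★ **THE CORNER PIECE READS THE SOURCE ONLY BELOW THE CORNER** (pointwise version of ✓`norm_cornerPiece_le_localised`): along a localised absorbing chain `U` with `U i ⊇` the step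
sites, `c ≤ d·L·(Π_{m<i} w_m)·Σ_{x∈U 0}Σ_μ‖G 0 x μ‖`. [cite: Balaban1985Averaging, (42)–(43) pp.23–24, (125) p.36] -/
theorem le_localised_of_steps_bound (L : ℕ) (hL : 1 ≤ L) (G : ℕ → Site d → Fin d → 𝔸) (a : ℕ → ℝ) (ha : ∀ m, 0 ≤ a m)
    (i : ℕ) (y : Site d) {c : ℝ}
    (hc : c ≤ ∑ r : Fin d → Fin L, ((L : ℝ) ^ d)⁻¹ *
      ((List.zip (List.scanl (fun (z : Site d) (l' : Letter d) => z + l'.vec) y (treeWord (boxVec L r))) (treeWord (boxVec L r))).map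
        fun s => ‖G i s.1 s.2.1‖).sum)
    (U : ℕ → Finset (Site d))
    (hUtop : ∀ (r : Fin d → Fin L),
      ∀ s ∈ List.zip (List.scanl (fun (z : Site d) (l' : Letter d) => z + l'.vec) y (treeWord (boxVec L r))) (treeWord (boxVec L r)), s.1 ∈ U i)
    (hpt : ∀ m, m < i → ∀ z ∈ U (m + 1), ∀ κ : Fin d, ‖G (m + 1) z κ‖ ≤
      ((L : ℝ) ^ d)⁻¹ * ∑ r : Fin d → Fin L, ∑ t ∈ Finset.range L, ‖G m ((L : ℤ) • z + boxVec L r + (t : ℤ) • e κ) κ‖ +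
        a m * ∑ s : Fin d → Fin L, ∑ ν : Fin d, (‖G m ((L : ℤ) • z + boxVec L s) ν‖ + ‖G m ((L : ℤ) • z + (L : ℤ) • e κ + boxVec L s) ν‖))
    (hU : ∀ m, m < i → ∀ z ∈ U (m + 1), ∀ (κ : Fin d) (r : Fin d → Fin L) (t : ℕ), t < L → (L : ℤ) • z + boxVec L r + (t : ℤ) • e κ ∈ U m)
    (hU' : ∀ m, m < i → ∀ z ∈ U (m + 1), ∀ (κ : Fin d) (s : Fin d → Fin L), (L : ℤ) • z + (L : ℤ) • e κ + boxVec L s ∈ U m) :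
    c ≤ d * L * ((∏ m ∈ Finset.range i, ((L : ℝ) * ((L : ℝ) ^ d)⁻¹ + 2 * d * a m)) * ∑ x ∈ U 0, ∑ μ : Fin d, ‖G 0 x μ‖) := by
  have h1 := le_box_of_steps_bound L hL (G i) y hc (U i) hUtop
  have h2 := sum_norm_tower_le_of_pointwise L hL G a ha i U hpt hU hU'
  have hdL : (0 : ℝ) ≤ d * L := by positivity
  exact h1.trans (mul_le_mul_of_nonneg_left h2 hdL)

/-! ## §4 The unrolled corner potential and the localised `ℓ¹` row -/

/-- `‖Λ_k z‖ ≤ Σ_{i<k}‖CM_i(G_i)(L^{k−1−i}•z)‖` — triangle inequality on the unrolled gauge function ✓`Prop7CornerCombChainPerCorner.gauge_unroll` (✓p704390's recursion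
`Λ_{k+1} z = CM_k(G_k) z + Λ_k(L•z)`, `Λ_0 = 0`, ANY corner maps `CM`). [cite: Balaban1985Averaging, (42)–(43) pp.23–24] -/
theorem norm_unrolled_le (L : ℕ) (CM : ℕ → (Site d → Fin d → 𝔸) → Site d → 𝔸) (G : ℕ → Site d → Fin d → 𝔸) (Λ : ℕ → Site d → 𝔸)
    (hΛ0 : ∀ z, Λ 0 z = 0) (hΛs : ∀ (k : ℕ) (z : Site d), Λ (k + 1) z = CM k (G k) z + Λ k ((L : ℤ) • z)) (k : ℕ) (z : Site d) :
    ‖Λ k z‖ ≤ ∑ i ∈ Finset.range k, ‖CM i (G i) (((L : ℤ) ^ (k - 1 - i)) • z)‖ := by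
  rw [gauge_unroll L CM G Λ hΛ0 hΛs k z]
  exact norm_sum_le _ _

/-- ★★★ **THE LOCALISED `ℓ¹` ROW FROM POINTWISE HYPOTHESES** (dressed-ready form of ✓p708982 `sum_norm_cornerComb_le_localised`, in ✓p704390's letters `CM G Λ`).  Data: a tower `G` with
pointwise one-step domination (weights `a_m ≥ 0`), corner maps `CM_i` obeying the tree-step bound (`‖CM_i(G_i) y‖ ≤ Σ_r L⁻ᵈ Σ_{steps}‖G_i(step)‖`), the gauge function by
`Λ_{k+1} z = CM_k(G_k) z + Λ_k(L•z)`, `Λ_0 = 0`, and the level-`k` structure bound `‖Q z κ‖ ≤ ‖G_k z κ‖ + ‖Λ_k z‖ + ‖Λ_k(z + e κ)‖` (✓`cornerComb_structure` + `Ad` non-expansive);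
absorbing chain `Z` (`Z k = Zk`) and localised chains `U i w`.  Then, with `w_m := L·L⁻ᵈ + 2d·a_m`,
`Σ_{z∈Zk}Σ_κ‖Q z κ‖ ≤ (Π_{m<k}w_m)·Σ_{Z 0}Σ_ν‖G 0‖ + d·L·Σ_{i<k}(Π_{m<i}w_m)·Σ_{z∈Zk}Σ_κ(Σ_{x∈U i (L^{k−1−i}•z) 0}Σ_μ‖G 0 x μ‖ + Σ_{x∈U i (L^{k−1−i}•(z+e κ)) 0}Σ_μ‖G 0 x μ‖)`.
«(O2) groundwork.» [cite: Balaban1985Averaging, (42)–(43) pp.23–24, (125) p.36, (119) p.35] -/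
theorem sum_norm_le_localised_of_pointwise (L : ℕ) (hL : 1 ≤ L) (G : ℕ → Site d → Fin d → 𝔸) (a : ℕ → ℝ) (ha : ∀ m, 0 ≤ a m)
    (CM : ℕ → (Site d → Fin d → 𝔸) → Site d → 𝔸) (Λ : ℕ → Site d → 𝔸) (hΛ0 : ∀ z, Λ 0 z = 0)
    (hΛs : ∀ (k : ℕ) (z : Site d), Λ (k + 1) z = CM k (G k) z + Λ k ((L : ℤ) • z))
    (k : ℕ) (Q : Site d → Fin d → 𝔸) (Zk : Finset (Site d))
    (hQ : ∀ z ∈ Zk, ∀ κ : Fin d, ‖Q z κ‖ ≤ ‖G k z κ‖ + ‖Λ k z‖ + ‖Λ k (z + e κ)‖)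
    (hpt : ∀ m, m < k → ∀ (z : Site d) (κ : Fin d), ‖G (m + 1) z κ‖ ≤
      ((L : ℝ) ^ d)⁻¹ * ∑ r : Fin d → Fin L, ∑ t ∈ Finset.range L, ‖G m ((L : ℤ) • z + boxVec L r + (t : ℤ) • e κ) κ‖ +
        a m * ∑ s : Fin d → Fin L, ∑ ν : Fin d, (‖G m ((L : ℤ) • z + boxVec L s) ν‖ + ‖G m ((L : ℤ) • z + (L : ℤ) • e κ + boxVec L s) ν‖))
    (hC : ∀ i, i < k → ∀ (y : Site d), ‖CM i (G i) y‖ ≤ ∑ r : Fin d → Fin L, ((L : ℝ) ^ d)⁻¹ *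
      ((List.zip (List.scanl (fun (z : Site d) (l' : Letter d) => z + l'.vec) y (treeWord (boxVec L r))) (treeWord (boxVec L r))).map
        fun s => ‖G i s.1 s.2.1‖).sum)
    (Z : ℕ → Finset (Site d)) (hZk : Z k = Zk)
    (hZ : ∀ m, m < k → ∀ z ∈ Z (m + 1), ∀ (κ : Fin d) (r : Fin d → Fin L) (t : ℕ), t < L → (L : ℤ) • z + boxVec L r + (t : ℤ) • e κ ∈ Z m)
    (hZ' : ∀ m, m < k → ∀ z ∈ Z (m + 1), ∀ (κ : Fin d) (s : Fin d → Fin L), (L : ℤ) • z + (L : ℤ) • e κ + boxVec L s ∈ Z m)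
    (U : ℕ → Site d → ℕ → Finset (Site d))
    (hUtop : ∀ i, i < k → ∀ (w : Site d) (r : Fin d → Fin L),
      ∀ s ∈ List.zip (List.scanl (fun (z : Site d) (l' : Letter d) => z + l'.vec) w (treeWord (boxVec L r))) (treeWord (boxVec L r)), s.1 ∈ U i w i)
    (hU : ∀ i, i < k → ∀ (w : Site d), ∀ m, m < i → ∀ z ∈ U i w (m + 1), ∀ (κ : Fin d) (r : Fin d → Fin L) (t : ℕ), t < L →
      (L : ℤ) • z + boxVec L r + (t : ℤ) • e κ ∈ U i w m)
    (hU' : ∀ i, i < k → ∀ (w : Site d), ∀ m, m < i → ∀ z ∈ U i w (m + 1), ∀ (κ : Fin d) (s : Fin d → Fin L),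
      (L : ℤ) • z + (L : ℤ) • e κ + boxVec L s ∈ U i w m) :
    ∑ z ∈ Zk, ∑ κ : Fin d, ‖Q z κ‖ ≤
      (∏ m ∈ Finset.range k, ((L : ℝ) * ((L : ℝ) ^ d)⁻¹ + 2 * d * a m)) * ∑ y ∈ Z 0, ∑ ν : Fin d, ‖G 0 y ν‖ +
        d * L * ∑ i ∈ Finset.range k, (∏ m ∈ Finset.range i, ((L : ℝ) * ((L : ℝ) ^ d)⁻¹ + 2 * d * a m)) *
          ∑ z ∈ Zk, ∑ κ : Fin d,
            (∑ x ∈ U i (((L : ℤ) ^ (k - 1 - i)) • z) 0, ∑ μ : Fin d, ‖G 0 x μ‖ +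
              ∑ x ∈ U i (((L : ℤ) ^ (k - 1 - i)) • (z + e κ)) 0, ∑ μ : Fin d, ‖G 0 x μ‖) := by
  set w : ℕ → ℝ := fun m => (L : ℝ) * ((L : ℝ) ^ d)⁻¹ + 2 * d * a m with hw
  -- structure + unrolled potential, pointwise
  have hpoint : ∀ z ∈ Zk, ∀ κ : Fin d, ‖Q z κ‖ ≤ ‖G k z κ‖ +
      ∑ i ∈ Finset.range k, (‖CM i (G i) (((L : ℤ) ^ (k - 1 - i)) • z)‖ + ‖CM i (G i) (((L : ℤ) ^ (k - 1 - i)) • (z + e κ))‖) := by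
    intro z hz κ
    have h1 := norm_unrolled_le L CM G Λ hΛ0 hΛs k z
    have h2 := norm_unrolled_le L CM G Λ hΛ0 hΛs k (z + e κ)
    rw [Finset.sum_add_distrib]
    linarith [hQ z hz κ]
  -- the G-tower along Z
  have hG : ∑ z ∈ Zk, ∑ κ : Fin d, ‖G k z κ‖ ≤ (∏ m ∈ Finset.range k, w m) * ∑ y ∈ Z 0, ∑ ν : Fin d, ‖G 0 y ν‖ := by
    rw [← hZk]
    exact sum_norm_tower_le_of_pointwise L hL G a ha k Z (fun m hm z _ κ => hpt m hm z κ) hZ hZ'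
  -- every corner value along its localised chain
  have hcorner : ∀ i, i < k → ∀ (y : Site d),
      ‖CM i (G i) y‖ ≤ d * L * ((∏ m ∈ Finset.range i, w m) * ∑ x ∈ U i y 0, ∑ μ : Fin d, ‖G 0 x μ‖) := by
    intro i hi y
    exact le_localised_of_steps_bound L hL G a ha i y (hC i hi y) (U i y) (hUtop i hi y)
      (fun m hm z _ κ => hpt m (hm.trans hi) z κ) (hU i hi y) (hU' i hi y)
  have hΛ : ∑ z ∈ Zk, ∑ κ : Fin d, ∑ i ∈ Finset.range k, (‖CM i (G i) (((L : ℤ) ^ (k - 1 - i)) • z)‖ + ‖CM i (G i) (((L : ℤ) ^ (k - 1 - i)) • (z + e κ))‖)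
      ≤ d * L * ∑ i ∈ Finset.range k, (∏ m ∈ Finset.range i, w m) *
          ∑ z ∈ Zk, ∑ κ : Fin d,
            (∑ x ∈ U i (((L : ℤ) ^ (k - 1 - i)) • z) 0, ∑ μ : Fin d, ‖G 0 x μ‖ +
              ∑ x ∈ U i (((L : ℤ) ^ (k - 1 - i)) • (z + e κ)) 0, ∑ μ : Fin d, ‖G 0 x μ‖) := by
    -- reorder to `Σ_i Σ_z Σ_κ`
    have hre : ∑ z ∈ Zk, ∑ κ : Fin d, ∑ i ∈ Finset.range k, (‖CM i (G i) (((L : ℤ) ^ (k - 1 - i)) • z)‖ + ‖CM i (G i) (((L : ℤ) ^ (k - 1 - i)) • (z + e κ))‖)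
        = ∑ i ∈ Finset.range k, ∑ z ∈ Zk, ∑ κ : Fin d, (‖CM i (G i) (((L : ℤ) ^ (k - 1 - i)) • z)‖ + ‖CM i (G i) (((L : ℤ) ^ (k - 1 - i)) • (z + e κ))‖) := by
      calc ∑ z ∈ Zk, ∑ κ : Fin d, ∑ i ∈ Finset.range k, (‖CM i (G i) (((L : ℤ) ^ (k - 1 - i)) • z)‖ + ‖CM i (G i) (((L : ℤ) ^ (k - 1 - i)) • (z + e κ))‖)
          = ∑ z ∈ Zk, ∑ i ∈ Finset.range k, ∑ κ : Fin d, (‖CM i (G i) (((L : ℤ) ^ (k - 1 - i)) • z)‖ + ‖CM i (G i) (((L : ℤ) ^ (k - 1 - i)) • (z + e κ))‖) :=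
            Finset.sum_congr rfl fun z _ => Finset.sum_comm
        _ = _ := Finset.sum_comm
    rw [hre, Finset.mul_sum]
    refine Finset.sum_le_sum fun i hi => ?_
    have hi' : i < k := Finset.mem_range.mp hi
    rw [Finset.mul_sum, Finset.mul_sum]
    refine Finset.sum_le_sum fun z _ => ?_
    rw [Finset.mul_sum, Finset.mul_sum]
    refine Finset.sum_le_sum fun κ _ => ?_
    have h1 := hcorner i hi' (((L : ℤ) ^ (k - 1 - i)) • z)
    have h2 := hcorner i hi' (((L : ℤ) ^ (k - 1 - i)) • (z + e κ))
    calc ‖CM i (G i) (((L : ℤ) ^ (k - 1 - i)) • z)‖ + ‖CM i (G i) (((L : ℤ) ^ (k - 1 - i)) • (z + e κ))‖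
        ≤ d * L * ((∏ m ∈ Finset.range i, w m) * ∑ x ∈ U i (((L : ℤ) ^ (k - 1 - i)) • z) 0, ∑ μ : Fin d, ‖G 0 x μ‖) +
          d * L * ((∏ m ∈ Finset.range i, w m) * ∑ x ∈ U i (((L : ℤ) ^ (k - 1 - i)) • (z + e κ)) 0, ∑ μ : Fin d, ‖G 0 x μ‖) := add_le_add h1 h2
      _ = _ := by ring
  have hsum : ∑ z ∈ Zk, ∑ κ : Fin d, ‖Q z κ‖ ≤ ∑ z ∈ Zk, ∑ κ : Fin d, ‖G k z κ‖ +
      ∑ z ∈ Zk, ∑ κ : Fin d, ∑ i ∈ Finset.range k, (‖CM i (G i) (((L : ℤ) ^ (k - 1 - i)) • z)‖ + ‖CM i (G i) (((L : ℤ) ^ (k - 1 - i)) • (z + e κ))‖) := by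
    rw [← Finset.sum_add_distrib]
    refine Finset.sum_le_sum fun z hz => ?_
    rw [← Finset.sum_add_distrib]
    exact Finset.sum_le_sum fun κ _ => hpoint z hz κ
  linarith [hsum, hG, hΛ]

end Summit.QuantumFields.YangMills.Theorems.Prop7CornerCombL1Engine
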